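/-
Copyright: cell pub-balaban-gaps (YM BLITZ Y1, track G1), seat g1-p2 GEN 11 (unit `pub-balaban-gaps-g1-p2`).  Row (D4) NODE O, MODEL level:
the ASSEMBLY — per-cube conjugated coercivity of 59b–66's one-scale covariant operator `covOp(u) = Δ_W(u) + m² + a_KP_K(U)(u)` on the fine
torus, COMPRESSED to a fibre-saturated cube `□̃`, from: the k-uniform base letter of the flat operator (112 `wCoercive_flatOp`, from
`form_lower18_unif`), gradient domination of 59b's `covDop` by the flat operator (111 `gradDom_covDop`, from the Gram identity and the defect
letters), the zeroth-order Schur budget and the first-order MULTIPLIER letters of the presentation (113), run through 109's abstract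
`conjCoercive_of_gradient` on the compressed index (109's `compress_presented`, `gradDom_compress`; the β cell's `conjCoercive_compress`).
Every constant is a function of `d, a, L, κ, ℓ, ℓ_B, β, β₀, γ_r, γ_c, α_K` — at `ℓ = η`, `ℓ_B = d` NOTHING depends on the scale `K`: the (L)
cube-level step of row (D4) NODE O for this carrier in FORM currency (g1-plan-1 GEN 38 (σ′)(τ)(υ)).  HONEST FRAMING: model level; the windows
(66's (3.37) letters), the averaging budget (64) and the weight are hypothesis data; the GLOBAL margin of 104's END stays k-dependent on this
carrier ((σ)); Bałaban's `Δ^{(k)}(𝐔)` NOT constructed; (D4) instance 0∕1; NOT BetaPertH, NOT continuum, NOT Clay.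
-/
import Summits.QuantumFields.BalabanUV.Gaps.D4WalkBlockFormCoercive
import Summits.QuantumFields.BalabanUV.Gaps.D4WalkBlockFormGradientTorus
import Summits.QuantumFields.BalabanUV.Gaps.D4WalkBlockFormShiftTorus

/-!
# `Gaps.D4WalkBlockFormCovOpTorus` — per-cube conjugated coercivity of the one-scale covariant operator on the fine torus with k-free
# constants: the assembly of 109 ∕ 111 ∕ 112 ∕ 113 (cell pub-balaban-gaps, seat g1-p2 gen 11)

HONEST DEPENDENCY (cell pub-balaban, verbatim): continuum YM on T⁴ ⇐ BetaPertH ∧ nine spine estimates (0/9 proved); BetaPertH ⇐ (D1) ∧ (D4) ∧ CAP+tail.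

[B9] Cor. 3.6 p. 408 ∕ p. 409: the local inverses `G′_□` of the gauged operator exist with scale-free constants because `Δ′(1)` is bounded
below (Thms 3.1–3.3) and `V′` is small in the (3.37) window.  THIS FILE ([folklore] assembly):
* **`conjCoercive_compress_covOp`** — for `a > 0`, `m² ≥ 0`, `K ≥ 1`, `α_K ≥ 0`; a weight `ρ` fibre-constant, moving by `≤ ℓ` across fine bonds and by
  `≤ ℓ_B` on K-blocks; a fibre-saturated `S`; windows `rows, cols W^±_μ(u,x) ≤ ηβ`, `rows, cols Σ_μ(W⁺_μ + W⁻_μ)(u,x) ≤ η²β₀` on the ball;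
  conjugated Schur sums `γ_r, γ_c` of `compress (P_K(U)(u) − P_K ⊗ 1) S`; `0 < t`, `tβγ ≤ 2` with `γ = 2(1 + e^{2|κ|ℓ})`:
  `M·‖z‖² ≤ Re conjForm (compress (covOp u) S) κ ρ z` on the ball, `M = (1 − tβγ∕2)m_w − (β₀ + ½α(γ_r + γ_c)) − Σ_ι β∕(2t) − tβc_D∕2`,
  `m_w = min{8, a(1 − L⁻²)} − 2dη⁻²(cosh(|κ|ℓ) − 1) − α(cosh(|κ|ℓ_B) − 1)`, `c_D = (1 + e^{2|κ|ℓ})(2αe^{|κ|ℓ_B} + 4d(η⁻¹(e^{|κ|ℓ} − 1))²)`.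
WHAT IT IS NOT.  The gauge presentation `fibD g·covOp(U)·fibD g⁻ = covOp(U^g)` (66 ∕ 90 ∕ 91a) that turns this into 104's per-cube `hcoer`, the
windows from (3.37) on `X` (66), the averaging budget (64), and the GLOBAL margin (104's `hq`, k-dependent here per (σ)) are NOT here; (D4)
instance 0∕1; words of row (D4) UNCHANGED (`ExistsUniformAcrossSmall 𝓣_Bałaban α Rσ₀ θ₀` + `TermDomination`, OBJECT level).

References (method only): T. Bałaban, Comm. Math. Phys. **99** (1985) 389–434 [B9], (3.37) p. 396, Thms 3.1–3.3 pp. 397–399, (3.42) p. 399,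
(3.50)–(3.54) pp. 400–401, Cor. 3.6 p. 408, p. 409.
-/

noncomputable section

namespace Summit.QuantumFields.BalabanUV.Gaps.D4WalkBlockFormCovOpTorus

open Metric Set Finset Complex Matrix
open scoped BigOperators Matrix ComplexConjugate
open Literature.MathematicalPhysics.QuantumFieldTheory.Balaban1983to89
open Literature.MathematicalPhysics.QuantumFieldTheory.Balaban1983to89.B5Prop11Lower (nsq nsq_nonneg)
open Summit.QuantumFields.BalabanUV.Beta.UnitLatticeLocalInverse (compress conjCoercive_compress)
open Summit.QuantumFields.BalabanUV.Beta.UnitLatticeNearFar (compress_add)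
open Summit.QuantumFields.BalabanUV.Beta.AccretiveCombesThomas (conjForm)
open Summit.QuantumFields.BalabanUV.Gaps.D4WalkBlockCovariantGeometry (fibDiag)
open Summit.QuantumFields.BalabanUV.Gaps.D4WalkBlockCovariantShift (covDop covCoeff covCoeff₀ flatLap covCoeff_inl covCoeff_inr)
open Summit.QuantumFields.BalabanUV.Gaps.D4WalkBlockCovariantPropagator (Pf Vav covOp)
open Summit.QuantumFields.BalabanUV.Gaps.D4WalkBlockLocalInverse (cRow cCol re_conjForm_ge_neg_schur)
open Summit.QuantumFields.BalabanUV.Gaps.D4WalkBlockFormCoercive (conjCoercive_of_gradient compress_finset_sum gradDom_compress)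
open Summit.QuantumFields.BalabanUV.Gaps.D4WalkModelGaugedSchur (compress_mul_of_reducing_left)
open Summit.QuantumFields.BalabanUV.Gaps.D4WalkBlockFormGradientTorus (gradDom_covDop)
open Summit.QuantumFields.BalabanUV.Gaps.D4WalkBlockFormBaseTorus (wCoercive_flatOp re_conjForm_flatOp_sub_flatLap_ge)
open Summit.QuantumFields.BalabanUV.Gaps.D4WalkBlockFormShiftTorus (covOp_presented fibDiag_reduces letters_covCoeff schur_V₀)

variable {P : Params} {F : Type} [Fintype F] [DecidableEq F]
variable {E : Type*} [NormedAddCommGroup E] [NormedSpace ℂ E]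
variable {Wp Wm : Fin P.d → E → Site P 0 → Matrix F F ℂ} {PU : E → Matrix (Site P 0 × F) (Site P 0 × F) ℂ} {a msq : ℝ}

omit [Fintype F] [DecidableEq F] [NormedAddCommGroup E] [NormedSpace ℂ E] in
/-- the multipliers `−covCoeff ι u` reduce every fibre-saturated `S` (site-local fibre coefficients). -/
theorem neg_covCoeff_reduces {S : Finset (Site P 0 × F)} (hS : ∀ p ∈ S, ∀ b : F, (p.1, b) ∈ S) (ι : Fin P.d ⊕ Fin P.d) (u : E)
    (i j : Site P 0 × F) (h : (-covCoeff P F Wp Wm ι u) i j ≠ 0) : i ∈ S ↔ j ∈ S := by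
  rw [Matrix.neg_apply, neg_ne_zero] at h
  rcases ι with μ | μ
  · rw [covCoeff_inl] at h; exact fibDiag_reduces _ hS i j h
  · rw [covCoeff_inr] at h; exact fibDiag_reduces _ hS i j h

omit [NormedSpace ℂ E] in
/-- **PER-CUBE CONJUGATED COERCIVITY OF THE ONE-SCALE COVARIANT OPERATOR, k-FREE CONSTANTS.**  See the module docstring for the letters; the
margin is 109's with `m = m_w` (112), `γ = 2(1 + e^{2|κ|ℓ})`, `c_D = (1 + e^{2|κ|ℓ})(2αe^{|κ|ℓ_B} + 4d(η⁻¹(e^{|κ|ℓ} − 1))²)` (111 + 112),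
`α₀ = ½((β₀ + αγ_r) + (β₀ + αγ_c))`, `β_r(ι) = β_c = β` (113). [cite: Balaban1985BackgroundPropagators, Thms 3.1–3.3 p.399, (3.52)–(3.54) pp.400–401, Cor. 3.6 p.408, p.409] -/
theorem conjCoercive_compress_covOp (ha : 0 < a) (hmsq : 0 ≤ msq) (hK : 1 ≤ P.K) (hα : 0 ≤ B1RG242Torus.α P a P.K) {ℓ ℓB : ℝ} (hℓ : 0 ≤ ℓ)
    (ρ : Site P 0 × F → ℝ) (hρ : ∀ (p : Site P 0 × F) (μ : Fin P.d), |ρ p - ρ (Site.shift p.1 μ, p.2)| ≤ ℓ)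
    (hρB : ∀ (x x' : Site P 0) (b : F), Site.proj P.K (B1RG242Torus.lvl P P.K) x' = Site.proj P.K (B1RG242Torus.lvl P P.K) x →
      |ρ (x, b) - ρ (x', b)| ≤ ℓB)
    (hρF : ∀ (x : Site P 0) (b b' : F), ρ (x, b) = ρ (x, b'))
    (S : Finset (Site P 0 × F)) (hS : ∀ p ∈ S, ∀ b : F, (p.1, b) ∈ S) {R β β₀ γr γc t : ℝ} (κ : ℝ)
    (hWp : ∀ μ, ∀ u ∈ ball (0 : E) R, ∀ x b, ∑ b', ‖Wp μ u x b b'‖ ≤ P.eps * β ∧ ∑ b', ‖Wp μ u x b' b‖ ≤ P.eps * β)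
    (hWm : ∀ μ, ∀ u ∈ ball (0 : E) R, ∀ x b, ∑ b', ‖Wm μ u x b b'‖ ≤ P.eps * β ∧ ∑ b', ‖Wm μ u x b' b‖ ≤ P.eps * β)
    (hW0 : ∀ u ∈ ball (0 : E) R, ∀ x b, ∑ b', ‖(∑ μ, (Wp μ u x + Wm μ u x)) b b'‖ ≤ P.eps ^ 2 * β₀ ∧
      ∑ b', ‖(∑ μ, (Wp μ u x + Wm μ u x)) b' b‖ ≤ P.eps ^ 2 * β₀)
    (hAr : ∀ u ∈ ball (0 : E) R, ∀ e : S, cRow (compress (PU u - Pf P F) S) κ (fun e : S => ρ e) e ≤ γr)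
    (hAc : ∀ u ∈ ball (0 : E) R, ∀ e : S, cCol (compress (PU u - Pf P F) S) κ (fun e : S => ρ e) e ≤ γc)
    (hβ : 0 ≤ β) (ht : 0 < t) (htγ : t * β * ((1 + Real.exp (2 * (|κ| * ℓ))) * 2) ≤ 2) :
    ∀ u ∈ ball (0 : E) R, ∀ z : S → ℂ,
      ((1 - t * β * ((1 + Real.exp (2 * (|κ| * ℓ))) * 2) / 2)
          * (min 8 (a * (1 - (((P.L : ℝ)) ^ 2)⁻¹)) - (0 + 2 * P.d * (P.eps⁻¹ ^ 2 * (Real.cosh (|κ| * ℓ) - 1))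
              + B1RG242Torus.α P a P.K * (Real.cosh (|κ| * ℓB) - 1)))
        - ((β₀ + B1RG242Torus.α P a P.K * γr) + (β₀ + B1RG242Torus.α P a P.K * γc)) / 2
        - (∑ _ι : Fin P.d ⊕ Fin P.d, β) / (2 * t)
        - t * β * ((1 + Real.exp (2 * (|κ| * ℓ))) * (2 * (B1RG242Torus.α P a P.K * Real.exp (|κ| * ℓB))
            + 4 * P.d * (P.eps⁻¹ * (Real.exp (|κ| * ℓ) - 1)) ^ 2)) / 2) * nsq z
      ≤ (conjForm (compress (covOp P F Wp Wm PU a msq u) S) κ (fun e : S => ρ e) z).re := by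
  intro u hu z
  have hsum : compress (∑ ι, -covCoeff P F Wp Wm ι u * covDop P F ι) S = ∑ ι, compress (-covCoeff P F Wp Wm ι u) S * compress (covDop P F ι) S := by
    rw [compress_finset_sum]
    exact Finset.sum_congr rfl fun ι _ => compress_mul_of_reducing_left (fun i j h => neg_covCoeff_reduces hS ι u i j h) _
  rw [covOp_presented u, compress_add, compress_add, hsum]
  exact conjCoercive_of_gradient (compress _ S) (compress _ S) (fun ι => compress (-covCoeff P F Wp Wm ι u) S)
    (fun ι => compress (covDop P F ι) S) κ (fun e : S => ρ e)
    (conjCoercive_compress _ κ ρ (wCoercive_flatOp ρ ha hmsq hK hα hρ hρB κ))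
    (gradDom_compress _ (covDop P F) S κ ρ (gradDom_covDop κ ρ hℓ hρ _ (re_conjForm_flatOp_sub_flatLap_ge ρ hmsq hα hρB κ)))
    (re_conjForm_ge_neg_schur _ κ _ (fun e => (schur_V₀ ρ hρF S hα hW0 κ hAr hAc u hu e).1) (fun e => (schur_V₀ ρ hρF S hα hW0 κ hAr hAc u hu e).2))
    (fun ι e => (letters_covCoeff ρ hρF S hWp hWm u hu ι κ e).1) (fun ι e => (letters_covCoeff ρ hρF S hWp hWm u hu ι κ e).2) ht hβ htγ z

end Summit.QuantumFields.BalabanUV.Gaps.D4WalkBlockFormCovOpTorus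

end
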